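import Summits.QuantumAdvantage.AdviceFreeQNC0.RingHardOdd
import Summits.QuantumAdvantage.AdviceFreeQNC0.WalkTransport
import HarnessLib

/-!
# Cell qa-qnc0 (odd primes, after F-Q1): the u-walk game over `𝔽_p` and the odd class — STATEMENTS

Planner qa-qnc0-p2 g12, ROUND-12 §B / `line12/Sketch12b.lean` §8, typed VERBATIM (statements only; the
withdrawn `RingHardOddHalf` is omitted).  The §7 statements `OddZeros`, `RingHardOdd p`, `RingHardOfOdd p` (and
the proof `ringHardOfOdd` of P7) live in `RingHardOdd.lean` (seat qa-qnc0-prover-2), imported here — this file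
declared them too in its first revision (landed in the same minute); they are REMOVED from this file so that the
tree has one home per name.  Shared by the proof files `OddPrimeTransport.lean` (P8 `WalkTransportF p` PROVED
for every prime `p`; `WalkHardF 2` and `RingHardOdd 2` unconditional from α's tube bound) and
`OddPrimeWitnesses.lean` (`ChargeTriple`, `WalkEasyThree`, `¬ WalkHardF 3` PROVED).

* §8  `HasDegF p` (`𝔽_p`-degree of a Boolean function), **`WalkHardF p`** (the u-walk game against
  `𝔽_p`-degree-polylog players — α's own game; `WalkHardF 2 = WalkHardAll`), **P8 `WalkTransportF p`**,
  the witnesses **`WalkEasyThree`** / **`ChargeTriple`**, and the sharp conjecture `WalkHardFTwoThirds p`.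

So for every prime `p ≥ 5` the advice-free separation `AdviceFreeQNC0Sep p` (2D HLF vs `FAC⁰[p]/rpoly`) is ONE
crux, `WalkHardF p`, plus the two re-runs P7/P8 (proved); `p = 3` is different (`WalkEasyThree`: the u-game is
won everywhere by a degree-`2` `𝔽₃` strategy).

WHAT THIS IS NOT: statements only — nothing is proved in this file; `WalkHardF p` (`p ≥ 5`) is an OPEN PROBLEM
(ROUND-12 §B.5–B.6: missing lemma "M2"); nothing on `p = 3` in `x`-coordinates (planner qa-qnc0-p1's ROUND-14);
separation NOT moved.
-/

noncomputable section

namespace Summit.QuantumAdvantage.AdviceFreeQNC0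

open Classical
open Finset
open Literature.Computability.QuantumComplexity Literature.Computability.MetaComplexity

/-! ### §8 The u-transport for ALL primes (ROUND-12 §B.5): only the BACKWARD chart is composed

`WalkTransport.rel_iff_ringWinU` + `hasDeg_transport` compose the ring strategy with
`xOfU u j = ¬(u_j ⊕ u_{j-1})` — a LOCAL map, of `𝔽_p`-degree `2` per coordinate for every `p`
(`1 − a − b + 2ab`).  So the walk game in `u`-coordinates bounds the ring game on the transposition
class for EVERY prime; the forward chart (prefix parities, `𝔽_p`-degree `i`) is never needed. -/

/-- `𝔽_p`-degree of a Boolean function (the `p`-analogue of `Elimination.HasDeg`; `HasDegF 2 = HasDeg`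
definitionally). (Sketch12b §8, verbatim.) -/
def HasDegF (p : ℕ) [Fact p.Prime] {n : ℕ} (f : (Fin n → Bool) → Bool) (d : ℕ) : Prop :=
  (fun x => if f x then (1 : ZMod p) else 0) ∈ Smolensky.lowDeg (ZMod p) n d

/-- **`WalkHardF p`** — the u-walk game (`ringWinU`: the number of `1`-outputs at cuts `g` with
`c + g + wt u + wtPrefix u g ≢ 0 (mod 3)` is odd) is hard for `𝔽_p`-degree-polylog players.
`WalkHardF 2` = `WalkHardAll` (PROVED, α: `OddPrimeTransport.walkHardF_two`); `WalkHardF 3` is FALSE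
(`OddPrimeWitnesses.not_walkHardF_three`); for `p ≥ 5` it is the cell's candidate crux for odd primes
(ROUND-12 §B.5; OPEN). (Sketch12b §8, verbatim.) -/
def WalkHardF (p : ℕ) [Fact p.Prime] : Prop :=
  ∃ θ : ℝ, θ < 1 ∧ ∀ C : ℕ, ∃ n₀ : ℕ, ∀ n ≥ n₀, ∀ c : ℕ, ∀ y : Fin (n + 1) → (Fin n → Bool) → Bool,
    (∀ g, HasDegF p (y g) ((Nat.log 2 n) ^ C)) →
      ((univ.filter fun u : Fin n → Bool => ringWinU c y u = true).card : ℝ) ≤ θ * (2 : ℝ) ^ n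

/-- P8 (M, any prime): the transport `WalkHardF p → RingHardOdd p` — re-run of
`ringHard_two_of_walkHard` on the transposition class with `comp_mem_lowDeg_of_coord` generalised to
coordinate maps of degree `≤ 2` (composite degree `≤ 2D`) and `xor` with `tGuess` costing another
factor `2` (`a ⊕ b = a + b − 2ab`); polylog stays polylog.  PROVED: `OddPrimeTransport.walkTransportF`
(degree `2(p−1)D + 4`, the factor `p − 1` from reading `[P = 1] = 1 − (P − 1)^{p−1}`).
(Sketch12b §8, verbatim.) -/
def WalkTransportF (p : ℕ) [Fact p.Prime] : Prop := WalkHardF p → RingHardOdd p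

/-- **`WalkEasyThree`** (S, explicit): at `p = 3` the u-game is WON EVERYWHERE by a degree-`2`
strategy — `y₀(u) = [(c + wt u) % 3 ≠ 0] = (c + Σ uᵢ)² ∈ 𝔽₃`, `y₁ = ¬ y₀`, all other outputs `0`
(the walk moves by `1 + u_g ∈ {1,2}`, so cuts `0,1` are never both off-support; exactly one counted
output).  Hence `¬ WalkHardF 3`: for `p = 3` the protection is the parity chart, not the walk.
PROVED: `OddPrimeWitnesses.walkEasyThree`. (Sketch12b §8, verbatim.) -/
def WalkEasyThree : Prop :=
  ∀ c n : ℕ, 1 ≤ n → ∃ y : Fin (n + 1) → (Fin n → Bool) → Bool,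
    (∀ g, HasDegF 3 (y g) 2) ∧ ∀ u : Fin n → Bool, ringWinU c y u = true

/-- **`ChargeTriple`** (S, pointwise identity): for every output vector and pattern, at most two of
the three charges `c, c+1, c+2` are won — each cut is off-support for exactly one charge, so the
three parities sum to `2·wt(y) ≡ 0`.  The u-game's "2/3 structure"; averaged over charges no
strategy of ANY complexity beats `2/3`.  PROVED: `OddPrimeWitnesses.chargeTriple`.
(Sketch12b §8, verbatim.) -/
def ChargeTriple : Prop :=
  ∀ (n c : ℕ) (y : Fin (n + 1) → (Fin n → Bool) → Bool) (u : Fin n → Bool),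
    (univ.filter fun ρ : Fin 3 => ringWinU (c + ρ.val) y u = true).card ≤ 2

/-- Conjecture/question (p ≥ 5; open even for `p = 2`, ROUND-11 §8.2): the u-game value for
mod-3-blind low-degree players is `2/3` (the `ChargeTriple` ceiling; kit j286448: every mod-2/mod-3-blind
strategy class measured sits AT `2/3`). (Sketch12b §8, verbatim.) -/
def WalkHardFTwoThirds (p : ℕ) [Fact p.Prime] : Prop :=
  ∀ ε : ℝ, 0 < ε → ∀ C : ℕ, ∃ n₀ : ℕ, ∀ n ≥ n₀, ∀ c : ℕ, ∀ y : Fin (n + 1) → (Fin n → Bool) → Bool,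
    (∀ g, HasDegF p (y g) ((Nat.log 2 n) ^ C)) →
      ((univ.filter fun u : Fin n → Bool => ringWinU c y u = true).card : ℝ) ≤ (2 / 3 + ε) * (2 : ℝ) ^ n

end Summit.QuantumAdvantage.AdviceFreeQNC0

end
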